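import Summits.ResolutionOfSingularities.ResolutionOfSingularities.Theorems.HomologicalConductorNoZenoBirthDefs
import Summits.ResolutionOfSingularities.ResolutionOfSingularities.Theorems.HomologicalConductorNoZenoTowerNoetherian
import Summits.ResolutionOfSingularities.ResolutionOfSingularities.Theorems.HomologicalConductorNoZenoNoetherianCase
import Summits.ResolutionOfSingularities.ResolutionOfSingularities.Theorems.HomologicalConductorNoZenoKernelLowDim
import Summits.ResolutionOfSingularities.ResolutionOfSingularities.Theorems.HomologicalConductorNoZenoIffKernel
import Summits.ResolutionOfSingularities.ResolutionOfSingularities.Theorems.HomologicalConductorNoZenoDim2RegularCentre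
import Summits.ResolutionOfSingularities.ResolutionOfSingularities.Theorems.SyzygyFlatteningHigherRankTerminationLocAt
import Literature.AlgebraicGeometry.Resolution.DominatedUnions
import Literature.AlgebraicGeometry.Resolution.PrimeDivisors
import HarnessLib

/-!
# Crux `NoZeno` (stmt-ResolutionOfSingularities-16483), line `birth`: exhaustion in dimension two

Route `ResolutionOfSingularities/HomologicalConductor`, crux
`Summit.ResolutionOfSingularities.ResolutionOfSingularities.Theses.HomologicalConductor.NoZeno`,
registered stub `stub_kernelRankOne` (skeleton v5, `Cruxes/NoZeno/Lines/birth.lean`).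

`Cruxes/NoZeno/KERNEL.md` splits the kernel of the crux (no noetherian valuation ring dominates
the canonical normalised `ca`-tower `T_m = tower O A m`) into Case A (the stages EXHAUST `O`:
`⋃ T_m = O`) and Case B (`T_∞ = ⋃ T_m` is not a valuation ring). This file proves that **in
transcendence degree `≤ 2` Case B contradicts the kernel hypothesis**, so the dimension-two
content of `stub_kernelRankOne` is the exhaustion case:

* `exh_exists_dominator_of_not_mem_tower` — (any dimension) if some `t ∈ O` lies in no stage,
  Abhyankar's Lemma 7 (tree `exists_valuationSubring_dominates_of_chain'`, applied to the chain
  of normal local stages `T₁ ⊆ T₂ ⊆ ⋯`) yields a valuation ring `W ∋ t` dominating the tower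
  (every stage lies in `W`, and `W`-units of a stage are `O`-units) in which the residue of `t`
  is transcendental over `k`: no non-zero `f ∈ k[X]` has `w(f(t)) > 0`.
* `exh_isDiscreteValuationRing_of_residually_transcendental` — (transcendence degree `≤ 2`) such
  a `W ≠ K` is a prime divisor (`tr.deg κ(W) ≥ 1 = tr.deg K − 1`), hence a discrete valuation
  ring (Zariski–Samuel VI §14 Thm 31, tree `isDiscreteValuationRing_of_primeDivisor`).
* `exh_exhausts_of_kernel_of_trdeg_le_two` — hence, under the kernel hypothesis and
  `tr.deg_k K ≤ 2`, every element of `O` lies in some stage `T_m`.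

References: S. S. Abhyankar, *On the valuations centered in a local domain*, Amer. J. Math. 78
(1956), Lemma 7; O. Zariski, P. Samuel, *Commutative Algebra* II, Ch. VI §14, Thm. 31.
-/

noncomputable section

-- single-problem summit: the doubled namespace component `ResolutionOfSingularities` is forced
set_option linter.dupNamespace false

namespace Summit.ResolutionOfSingularities.ResolutionOfSingularities.Theorems.NoZeno.Birth

open Summit.ResolutionOfSingularities.ResolutionOfSingularities.Theses.HomologicalConductor
open Literature.AlgebraicGeometry.Resolution Polynomial IsLocalRing

variable {k K : Type} [Field k] [Field K] [Algebra k K]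

/-! ## Residual transcendence in valuation form -/

/-- If no polynomial over a subring `R ⊇ k` of `K` with `w(p(t)) > 0` has a unit coefficient,
then no non-zero `f ∈ k[X]` has `w(f(t)) > 0` (map `f` to `R[X]`: same value at `t`, and the
leading coefficient is the image of a unit of `k`). [cite: Abhyankar1956Valuations, Lemma 7] -/
theorem exh_not_valuation_aeval_lt_one (W : ValuationSubring K) (R : Subring K)
    (hkR : ∀ c : k, algebraMap k K c ∈ R) {t : K}
    (hpoly : ∀ p : (↥R)[X], W.valuation (aeval t p) < 1 → ∀ j, ¬ IsUnit (p.coeff j))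
    (f : k[X]) (hf0 : f ≠ 0) : ¬ W.valuation (aeval t f) < 1 := by
  -- adapted from `SyzygyFlattening.not_dimZero_of_residually_transcendental`
  intro hf
  let φ : k →+* ↥R :=
    { toFun := fun c => ⟨algebraMap k K c, hkR c⟩
      map_one' := Subtype.ext (map_one _)
      map_mul' := fun a b => Subtype.ext (map_mul _ a b)
      map_zero' := Subtype.ext (map_zero _)
      map_add' := fun a b => Subtype.ext (map_add _ a b) }
  have hφ : (algebraMap ↥R K).comp φ = algebraMap k K := RingHom.ext fun _ => rfl
  have heval : aeval t (f.map φ) = aeval t f := by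
    rw [aeval_def, eval₂_map, hφ, ← aeval_def]
  have hunit : IsUnit ((f.map φ).coeff f.natDegree) := by
    rw [coeff_map, coeff_natDegree]
    exact (leadingCoeff_ne_zero.mpr hf0).isUnit.map φ
  refine hpoly (f.map φ) ?_ f.natDegree hunit
  rw [heval]
  exact hf

/-- Valuation form ⇒ residue form: if no non-zero `f ∈ k[X]` has `w(f(t)) > 0` (`t ∈ W ⊇ k`),
the residue of `t` in `κ(W)` is transcendental over `k`. [folklore] -/
theorem exh_algebraicIndependent_residue (W : ValuationSubring K)
    (hkW : ∀ c : k, algebraMap k K c ∈ W) {t : K} (htW : t ∈ W)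
    (hval : ∀ f : k[X], f ≠ 0 → ¬ W.valuation (aeval t f) < 1) :
    letI := algebraOfMem k W hkW
    AlgebraicIndependent k fun _ : Fin 1 => residue W ⟨t, htW⟩ := by
  letI := algebraOfMem k W hkW
  haveI := isScalarTower_algebraOfMem k W hkW
  rw [algebraicIndependent_unique_type_iff, transcendental_iff]
  intro f hf
  by_contra hf0
  refine hval f hf0 ?_
  -- `residue (f(t)) = f(residue t) = 0`, i.e. `f(t) ∈ 𝔪_W`, i.e. `w(f(t)) > 0`
  have h1 : residue W (aeval (⟨t, htW⟩ : W) f) = 0 := by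
    have h := aeval_algHom_apply (IsScalarTower.toAlgHom k W (ResidueField W)) (⟨t, htW⟩ : W) f
    simp only [IsScalarTower.coe_toAlgHom', ResidueField.algebraMap_eq] at h
    rw [← h]
    exact hf
  have h2 : aeval (⟨t, htW⟩ : W) f ∈ maximalIdeal W := (residue_eq_zero_iff _).mp h1
  have h3 : W.valuation ((aeval (⟨t, htW⟩ : W) f : W) : K) < 1 :=
    (W.valuation_lt_one_iff _).mp h2
  have h4 : ((aeval (⟨t, htW⟩ : W) f : W) : K) = aeval t f := by
    have h := aeval_algHom_apply (IsScalarTower.toAlgHom k W K) (⟨t, htW⟩ : W) f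
    simp only [IsScalarTower.coe_toAlgHom'] at h
    exact h.symm
  rwa [h4] at h3

/-- **In transcendence degree `≤ 2`, a non-trivial valuation ring `W ∋ k` of the finitely
generated `K/k` holding an element whose residue is transcendental over `k` is a discrete
valuation ring**: `tr.deg κ(W) ≥ 1 ≥ tr.deg K − 1` makes `W` a prime divisor
(Zariski–Samuel VI §14 Thm 31, tree `isDiscreteValuationRing_of_primeDivisor`).
[cite: ZariskiSamuel1960, Ch. VI §14, Thm. 31] -/
theorem exh_isDiscreteValuationRing_of_residually_transcendental (W : ValuationSubring K)
    (hkW : ∀ c : k, algebraMap k K c ∈ W) (hfg : (⊤ : IntermediateField k K).FG) (hW : W ≠ ⊤)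
    {t : K} (htW : t ∈ W) (hval : ∀ f : k[X], f ≠ 0 → ¬ W.valuation (aeval t f) < 1)
    (htr : Algebra.trdeg k K ≤ 2) : IsDiscreteValuationRing ↥W := by
  letI := algebraOfMem k W hkW
  haveI := isScalarTower_algebraOfMem k W hkW
  have hy := exh_algebraicIndependent_residue W hkW htW hval
  have hN : Algebra.trdeg k K ≤ (1 : ℕ) + 1 := by
    rw [Nat.cast_one, one_add_one_eq_two]
    exact htr
  exact isDiscreteValuationRing_of_primeDivisor W hfg hW (fun _ : Fin 1 => (⟨t, htW⟩ : W)) hy hN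

/-! ## Abhyankar's Lemma 7 along the tower -/

/-- **A non-exhausted element is caught by a residually transcendental dominator.** If `t ∈ O`
lies in no stage of the tower (`A ⊆ O` finitely generated, `Frac A = K`), there is a valuation
ring `W ∋ t` of `K` DOMINATING the tower — every stage lies in `W` and the `W`-units of every
stage are `O`-units — such that no non-zero `f ∈ k[X]` has `w(f(t)) > 0` (the residue of `t` is
transcendental over `k`, indeed over every `κ(T_m)`). Proof: `t⁻¹` lies in no stage either
(stages invert their `O`-units); the stages `T₁ ⊆ T₂ ⊆ ⋯` are local, integrally closed in `K`
(normal with fraction field `K`) and each dominated by the next, so Abhyankar's Lemma 7 (tree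
`exists_valuationSubring_dominates_of_chain'`) applies. [cite: Abhyankar1956Valuations, Lemma 7] -/
theorem exh_exists_dominator_of_not_mem_tower (O : ValuationSubring K) (A : Subalgebra k K)
    (hk : ∀ c : k, algebraMap k K c ∈ O) (hA : A.FG) (hfr : IsFractionRing ↥A K)
    (hAO : A.toSubring ≤ O.toSubring) {t : K} (htO : t ∈ O) (ht : ∀ m : ℕ, t ∉ tower O A m) :
    ∃ W : ValuationSubring K, t ∈ W ∧
      (∀ m : ℕ, ∀ s ∈ tower O A m, s ∈ W ∧ (s⁻¹ ∈ W → s⁻¹ ∈ O)) ∧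
      ∀ f : k[X], f ≠ 0 → ¬ W.valuation (aeval t f) < 1 := by
  -- adapted from `SyzygyFlattening.stub_union_dichotomy`
  haveI := hfr
  have hTO : ∀ m, (tower O A m).toSubring ≤ O.toSubring :=
    fun m x hx => mem_valuationSubring_of_mem_tower O hk hAO m x hx
  -- every stage `T_m = loc O B` (`B ⊆ O`) is local and inverts its `O`-units
  have hinv : ∀ m {s : K}, s ∈ tower O A m → s⁻¹ ∈ O → s⁻¹ ∈ tower O A m := by
    intro m s hs hsO
    by_cases hs0 : s = 0
    · rw [hs0, inv_zero]; exact (tower O A m).zero_mem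
    have hsO' : s ∈ O := hTO m hs
    obtain ⟨B, hBO, hTB⟩ := exists_tower_eq_loc O A hk hAO m
    rw [hTB, loc_eq_locAt] at hs ⊢
    exact SyzygyFlattening.inv_mem_locAt O B hBO hs
      (SyzygyFlattening.valuation_eq_one_of_inv_mem O hsO' hsO hs0)
  have hlocT : ∀ m, IsLocalRing ↥(tower O A m) := by
    intro m
    obtain ⟨B, hBO, hTB⟩ := exists_tower_eq_loc O A hk hAO m
    rw [hTB, loc_eq_locAt]
    exact SyzygyFlattening.isLocalRing_locAt O B hBO
  -- the chain of normal local stages `R i = T (i + 1)`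
  let R : ℕ → Subring K := fun i => (tower O A (i + 1)).toSubring
  have hloc : ∀ i, IsLocalRing (R i) := fun i => hlocT (i + 1)
  have hdom : ∀ i, SubringDominates (R i) (R (i + 1)) := fun i =>
    ⟨fun x hx => d2rc_mem_tower_of_le O A (Nat.le_succ (i + 1)) hx,
      fun x hx hxinv => hinv (i + 1) hx (hTO (i + 2) hxinv)⟩
  have hint : ∀ i, IsIntegrallyClosedIn (R i) K := fun i => by
    haveI : IsIntegrallyClosed (R i) := d2rc_isIntegrallyClosed_tower_succ O A hk hA hfr hAO i
    haveI : IsFractionRing (R i) K :=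
      isFractionRing_subalgebra_of_le A (tower O A (i + 1))
        (tn_tower_invariant O A hk hA hfr hAO (i + 1)).1
    exact (isIntegrallyClosed_iff_isIntegrallyClosedIn K).mp ‹_›
  have htR : ∀ i, t ∉ R i := fun i h => ht (i + 1) h
  have htR' : ∀ i, t⁻¹ ∉ R i := fun i h => ht (i + 1) (by
    have h' := hinv (i + 1) h (by rw [inv_inv]; exact htO)
    rwa [inv_inv] at h')
  -- Abhyankar's Lemma 7
  obtain ⟨W, htW, hWdom, hpoly⟩ :=
    exists_valuationSubring_dominates_of_chain' R hloc hdom hint htR htR'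
  refine ⟨W, htW, fun m s hs => ?_, ?_⟩
  · have hs' : s ∈ R m := d2rc_mem_tower_of_le O A (Nat.le_succ m) hs
    exact ⟨(hWdom m).1 hs', fun h => hTO (m + 1) ((hWdom m).2 s hs' h)⟩
  · exact exh_not_valuation_aeval_lt_one W (R 0)
      (fun c => mem_tower_of_mem O A 1 _ (A.algebraMap_mem c)) (hpoly 0)

/-! ## Exhaustion in transcendence degree `≤ 2` -/

/-- **Exhaustion under the kernel hypothesis, transcendence degree `≤ 2`.** If no noetherian
valuation ring dominates the canonical normalised `ca`-tower of `A ⊆ O` (`A` finitely generated,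
`Frac A = K`, `tr.deg_k K ≤ 2`), then the stages EXHAUST `O`: every `x ∈ O` lies in some `T_m`
(so `⋃ T_m = O` and `O` is the only valuation ring dominating the tower). Indeed an `x ∈ O`
outside every stage is caught by a dominator `W ∋ x` with residually transcendental `x`
(`exh_exists_dominator_of_not_mem_tower`); `W = K` is noetherian, and `W ≠ K` is a prime
divisor, hence a DVR (`exh_isDiscreteValuationRing_of_residually_transcendental`) — either way a
noetherian dominator. This settles Case B of `Cruxes/NoZeno/KERNEL.md` in dimension two: there
the rank-one kernel `stub_kernelRankOne` is the exhaustion case `⋃ T_m = O`.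
[cite: Abhyankar1956Valuations, Lemma 7] -/
theorem exh_exhausts_of_kernel_of_trdeg_le_two (k K : Type) [Field k] [Field K] [Algebra k K]
    (O : ValuationSubring K) (A : Subalgebra k K) (hk : ∀ c : k, algebraMap k K c ∈ O)
    (hA : A.FG) (hfr : IsFractionRing ↥A K) (hAO : A.toSubring ≤ O.toSubring)
    (hker : ∀ O' : ValuationSubring K,
      (∀ m : ℕ, ∀ s ∈ tower O A m, s ∈ O' ∧ (s⁻¹ ∈ O' → s⁻¹ ∈ O)) → ¬ IsNoetherianRing ↥O')
    (htr : Algebra.trdeg k K ≤ 2) (x : K) (hx : x ∈ O) : ∃ m : ℕ, x ∈ tower O A m := by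
  by_contra hxT
  push Not at hxT
  obtain ⟨W, hxW, hdomW, hval⟩ := exh_exists_dominator_of_not_mem_tower O A hk hA hfr hAO hx hxT
  refine hker W hdomW ?_
  by_cases hW : W = ⊤
  · exact isNoetherianRing_of_eq_top W hW
  · haveI := hfr
    haveI : Algebra.FiniteType k ↥A := A.fg_iff_finiteType.mp hA
    have hfg : (⊤ : IntermediateField k K).FG :=
      IntermediateField.fg_top_of_isFractionRing_of_finiteType k ↥A K
    have hkW : ∀ c : k, algebraMap k K c ∈ W :=
      fun c => (hdomW 0 _ (mem_tower_of_mem O A 0 _ (A.algebraMap_mem c))).1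
    haveI : IsDiscreteValuationRing ↥W :=
      exh_isDiscreteValuationRing_of_residually_transcendental W hkW hfg hW hxW hval htr
    infer_instance

/-- **Corollary: in transcendence degree `≤ 2` the kernel tower has `O` as its ONLY dominator.**
A valuation ring `O'` dominating the tower contains `⋃ T_m = O`; and if `y ∈ O' ∖ O` then
`y⁻¹ ∈ O` lies in some stage, is inverted in `O'`, hence inverted in `O` — so `y ∈ O`,
contradiction. [cite: ZariskiSamuel1960, VI §5] -/
theorem exh_dominator_eq_of_kernel_of_trdeg_le_two (k K : Type) [Field k] [Field K] [Algebra k K]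
    (O : ValuationSubring K) (A : Subalgebra k K) (hk : ∀ c : k, algebraMap k K c ∈ O)
    (hA : A.FG) (hfr : IsFractionRing ↥A K) (hAO : A.toSubring ≤ O.toSubring)
    (hker : ∀ O' : ValuationSubring K,
      (∀ m : ℕ, ∀ s ∈ tower O A m, s ∈ O' ∧ (s⁻¹ ∈ O' → s⁻¹ ∈ O)) → ¬ IsNoetherianRing ↥O')
    (htr : Algebra.trdeg k K ≤ 2) (O' : ValuationSubring K)
    (hdom : ∀ m : ℕ, ∀ s ∈ tower O A m, s ∈ O' ∧ (s⁻¹ ∈ O' → s⁻¹ ∈ O)) : O' = O := by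
  have hOO' : O ≤ O' := fun x hx => by
    obtain ⟨m, hm⟩ := exh_exhausts_of_kernel_of_trdeg_le_two k K O A hk hA hfr hAO hker htr x hx
    exact (hdom m x hm).1
  refine le_antisymm (fun y hy => ?_) hOO'
  by_contra hyO
  -- `y ∉ O` ⇒ `y⁻¹ ∈ 𝔪_O ⊆ O`, so `y⁻¹ ∈ T_m` for some `m`, and `(y⁻¹)⁻¹ = y ∈ O'` ⇒ `y ∈ O`
  have hy0 : y ≠ 0 := by rintro rfl; exact hyO O.zero_mem
  have hyinv : y⁻¹ ∈ O := by
    rcases O.mem_or_inv_mem y with h | h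
    · exact absurd h hyO
    · exact h
  obtain ⟨m, hm⟩ :=
    exh_exhausts_of_kernel_of_trdeg_le_two k K O A hk hA hfr hAO hker htr y⁻¹ hyinv
  have h := (hdom m y⁻¹ hm).2 (by rw [inv_inv]; exact hy)
  rw [inv_inv] at h
  exact hyO h

end Summit.ResolutionOfSingularities.ResolutionOfSingularities.Theorems.NoZeno.Birth

end
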